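import Mathlib

/-!
# V4U cone brick `HP₁`, cone side (4): contraction commutes with localising away from an element

(crux stmt-ResolutionOfSingularities-15640 `WildQuotients.WildQuotientResolution`, line `Sketch`,
sector `|G| = p`; programme V4U of `L/w45c/CHAIN.md` v7.4 §4 — the `hJ` input
`√(ψ⁻¹(𝔞·Γ(O))) = J₀` of lead-1's cone-brick transfer
`BlowupExit.exists_isBlowup_regular_of_invariantsPresentation` (p503610) for the `μ₂` brick, whose
invariant ring is the `½(1,1,1) × 𝔸` cone LOCALISED at the invariant `Q` (RULING v7.1; stub-4 OFFER
(O-b) 06:24:12Z). [OURS · L1 W4.5c] — generic commutative algebra, NOT a statement of any manuscript.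
Prover res-L1-w45c-stub-4.)

* `ConeVertex.algebraMap_mem_map_iff_of_away` — for `ι : R → B`, `S = R[1/q]`, `T = B[1/ι q]` and an
  ideal `J ⊆ B`: `ι r ∈ J·T ↔ r ∈ (ι⁻¹ J)·S` (both sides say `qᵏ r ∈ ι⁻¹ J` for some `k`).
* `ConeVertex.comap_awayMap_map` — hence along the induced map `ι′ : S → T`
  (`IsLocalization.Away.map`), `ι′⁻¹ (J·T) = (ι⁻¹ J)·S` EXACTLY; with p504476
  `Half111.comap_lift_span_X` (`ι⁻¹ (x_a, x_b, x_c) = 𝔪₂` for the presented cone ring) this is the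
  localised centre identification `ι′⁻¹ ((x_a, x_b, x_c)·k[x][1/Q]) = 𝔪₂·A[1/Q]`.
* `ConeVertex.radical_comap_awayMap_map` — the same after taking radicals (the literal `hJ` shape,
  `((Ideal.span 𝔞).comap ψ).radical = J₀`, once `√𝔞T` is known upstairs).
-/

-- single-problem summit: the doubled namespace component `ResolutionOfSingularities` is forced
set_option linter.dupNamespace false

namespace Summit.ResolutionOfSingularities.ResolutionOfSingularities.Theorems.WildQuotientResolution.ConeVertex

/-- For `ι : R → B`, `S = R[1/q]`, `T = B[1/ι q]`, `J ⊆ B`: `ι r / 1 ∈ J·T ↔ r / 1 ∈ (ι⁻¹ J)·S`.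
[folklore] -/
theorem algebraMap_mem_map_iff_of_away {R B S T : Type*} [CommRing R] [CommRing B] [CommRing S]
    [CommRing T] [Algebra R S] [Algebra B T] (ι : R →+* B) (q : R) [IsLocalization.Away q S]
    [IsLocalization.Away (ι q) T] (J : Ideal B) (r : R) :
    algebraMap B T (ι r) ∈ J.map (algebraMap B T) ↔
      algebraMap R S r ∈ (Ideal.comap ι J).map (algebraMap R S) := by
  rw [IsLocalization.algebraMap_mem_map_algebraMap_iff (Submonoid.powers (ι q)),
    IsLocalization.algebraMap_mem_map_algebraMap_iff (Submonoid.powers q)]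
  constructor
  · rintro ⟨m, ⟨j, rfl⟩, hm⟩
    refine ⟨q ^ j, ⟨j, rfl⟩, ?_⟩
    rw [Ideal.mem_comap, map_mul, map_pow]
    exact hm
  · rintro ⟨m, ⟨j, rfl⟩, hm⟩
    refine ⟨ι q ^ j, ⟨j, rfl⟩, ?_⟩
    rw [Ideal.mem_comap, map_mul, map_pow] at hm
    exact hm

/-- **Contraction commutes with localising away from an element.** For `ι : R → B`, `q ∈ R`,
`S = R[1/q]`, `T = B[1/ι q]`, the induced `ι′ : S → T` and any ideal `J ⊆ B`:
`ι′⁻¹ (J·T) = (ι⁻¹ J)·S`. [folklore] -/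
theorem comap_awayMap_map {R B S T : Type*} [CommRing R] [CommRing B] [CommRing S]
    [CommRing T] [Algebra R S] [Algebra B T] (ι : R →+* B) (q : R) [IsLocalization.Away q S]
    [IsLocalization.Away (ι q) T] (J : Ideal B) :
    Ideal.comap (IsLocalization.Away.map S T ι q) (J.map (algebraMap B T)) =
      (Ideal.comap ι J).map (algebraMap R S) := by
  ext x
  obtain ⟨⟨r, s⟩, rfl⟩ := IsLocalization.mk'_surjective (Submonoid.powers q) x
  rw [Ideal.mem_comap, IsLocalization.Away.map, IsLocalization.map_mk', IsLocalization.mk'_mem_iff,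
    IsLocalization.mk'_mem_iff]
  exact algebraMap_mem_map_iff_of_away ι q J r

/-- The same after radicals: `√(ι′⁻¹ (J·T)) = (√… pulled back) = ((ι⁻¹ J)·S).radical`; in
particular if `(ι⁻¹ J)·S` is radical (e.g. prime: `Half111.isPrime_map_span_gens`, p504195) then
`√(ι′⁻¹ (J·T)) = (ι⁻¹ J)·S` — the literal `hJ` shape of p503610. [folklore] -/
theorem radical_comap_awayMap_map {R B S T : Type*} [CommRing R] [CommRing B] [CommRing S]
    [CommRing T] [Algebra R S] [Algebra B T] (ι : R →+* B) (q : R) [IsLocalization.Away q S]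
    [IsLocalization.Away (ι q) T] (J : Ideal B) (J₀ : Ideal S) (hJ₀ : J₀.IsRadical)
    (h : (Ideal.comap ι J).map (algebraMap R S) = J₀) :
    (Ideal.comap (IsLocalization.Away.map S T ι q) (J.map (algebraMap B T))).radical = J₀ := by
  rw [comap_awayMap_map, h]
  exact hJ₀.radical

/-- Variant with a radical upstairs: if `K ⊆ T` has the same radical as `J·T` then
`√(ι′⁻¹ K) = √((ι⁻¹ J)·S)`. [folklore] -/
theorem radical_comap_awayMap_of_radical_eq {R B S T : Type*} [CommRing R] [CommRing B]
    [CommRing S] [CommRing T] [Algebra R S] [Algebra B T] (ι : R →+* B) (q : R)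
    [IsLocalization.Away q S] [IsLocalization.Away (ι q) T] (J : Ideal B) (K : Ideal T)
    (hK : K.radical = (J.map (algebraMap B T)).radical) :
    (Ideal.comap (IsLocalization.Away.map S T ι q) K).radical =
      ((Ideal.comap ι J).map (algebraMap R S)).radical := by
  rw [← Ideal.comap_radical, hK, Ideal.comap_radical, comap_awayMap_map]

end Summit.ResolutionOfSingularities.ResolutionOfSingularities.Theorems.WildQuotientResolution.ConeVertex
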